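import Literature.AlgebraicGeometry.Frobenioids.KummerReciprocityFunctoriality
import HarnessLib

/-!
# Frobenioids II, Definition 2.2: conjugation on the Kummer data

Mochizuki, *The geometry of Frobenioids II*, Kyushu J. Math. **62** (2008) 401–460, §2, Definition
2.2 (i)–(ii) p. 17 and Remark 2.4.1 p. 22 [cite: MochizukiFrdII2008, Def 2.2 (ii) p.17].
Specialisation of `KummerReciprocityFunctoriality.lean` to conjugation by an element `γ` of the
ambient group `Γ` (= `Aut_E(A_E)`) acting on `O^□(A)`: if `γ K γ⁻¹ = K'` for subgroups
`K, K' ≤ Γ` and `q' = γ q γ⁻¹`, the coefficient modules `μ_N(A)` (`x ↦ γ⁻¹ x`) and `ℤ/Nℤ` transport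
(`conjTransportMu`, `conjTransportTriv`), so condition (c) of Def. 2.2 (ii) is invariant
(`isCohSaturated_iff_of_conj`, PROVED) — "[conditions which are unaffected by composition with
conjugation by an element of `G`]". For `K' = K` this yields the natural action of the normaliser
of `H_A` (e.g. of `G_A`, for `A_D` Galois) on `Hⁿ(H_A, μ_N(A))` in continuous cohomology
(`cohAct`) and on `H¹(H_A, μ_N(A))` in Mathlib's group cohomology where the Kummer classes live
(`h1Act`) — "the various natural actions of `(Gᵢ)_{Aᵢ}/(Hᵢ)_{Aᵢ}`" of Theorem 2.4 (i) p. 20 and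
Remark 2.4.1 p. 22. No item of [FrdII] is restated here.
-/

namespace Literature.AlgebraicGeometry.Frobenioids

namespace Kummer

open CategoryTheory groupCohomology

variable {Γ : Type} [Group Γ] [TopologicalSpace Γ] [DiscreteTopology Γ]
  (N : ℕ) (O : Type) [CommMonoid O] [MulDistribMulAction Γ O]
  {H : Type} [Group H] [TopologicalSpace H] [IsTopologicalGroup H]

/-! ### Conjugation between subgroups -/

/-- Conjugation `k ↦ γ k γ⁻¹ : K → K'` as a continuous homomorphism (discrete groups).
[cite: MochizukiFrdII2008, Def 2.2 (i) p.17] -/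
def conjSubgroupHom (γ : Γ) (K K' : Subgroup Γ) (hK : ∀ k ∈ K, γ * k * γ⁻¹ ∈ K') : K →ₜ* K' where
  toFun k := ⟨γ * k * γ⁻¹, hK k k.2⟩
  map_one' := Subtype.ext (by simp)
  map_mul' a b := Subtype.ext (by simp only [Subgroup.coe_mul]; group)
  continuous_toFun := continuous_of_discreteTopology

/-- Value of `conjSubgroupHom`. [cite: MochizukiFrdII2008, Def 2.2 (i) p.17] -/
@[simp] theorem coe_conjSubgroupHom_apply (γ : Γ) (K K' : Subgroup Γ)
    (hK : ∀ k ∈ K, γ * k * γ⁻¹ ∈ K') (k : K) :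
    (conjSubgroupHom γ K K' hK k : Γ) = γ * k * γ⁻¹ := rfl

omit [TopologicalSpace Γ] [DiscreteTopology Γ] in
/-- `γ⁻¹ (γ k γ⁻¹) y = k γ⁻¹ y` in `μ_N(A)`. [cite: MochizukiFrdII2008, Def 2.2 (ii) p.17] -/
theorem inv_smul_conj_smul (γ k : Γ) (y : Mu N O) : γ⁻¹ • ((γ * k * γ⁻¹) • y) = k • (γ⁻¹ • y) := by
  rw [smul_smul, smul_smul]
  congr 1
  group

omit [TopologicalSpace Γ] [DiscreteTopology Γ] in
/-- `γ (γ⁻¹ k γ) y = k γ y` in `μ_N(A)`. [cite: MochizukiFrdII2008, Def 2.2 (ii) p.17] -/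
theorem smul_conj_inv_smul (γ k : Γ) (y : Mu N O) : γ • ((γ⁻¹ * k * γ) • y) = k • (γ • y) := by
  rw [smul_smul, smul_smul]
  congr 1
  group

section Conj

variable (K K' : Subgroup Γ) (γ : Γ) (hK : ∀ k ∈ K, γ * k * γ⁻¹ ∈ K')
  (hK' : ∀ k' ∈ K', γ⁻¹ * k' * γ ∈ K) (q : H →ₜ* K) (q' : H →ₜ* K')
  (hq' : ∀ h, (q' h : Γ) = γ * q h * γ⁻¹)

/-- The inverse conjugation `K' → K`. [cite: MochizukiFrdII2008, Def 2.2 (i) p.17] -/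
def conjSubgroupHomInv : K' →ₜ* K :=
  conjSubgroupHom γ⁻¹ K' K (fun k hk => by simpa using hK' k hk)

/-- The coefficient map `x ↦ γ⁻¹ x` on `μ_N(A)`, over `k ↦ γ k γ⁻¹`.
[cite: MochizukiFrdII2008, Def 2.2 (ii) p.17] -/
def muConjHom : TopRep.res (conjSubgroupHom γ K K' hK : K →* K') (muTopRep N O K') ⟶
    muTopRep N O K :=
  TopRep.ofHom
    { toContinuousLinearMap :=
        (⟨Representation.ofMulDistribMulAction Γ (Mu N O) γ⁻¹, continuous_of_discreteTopology⟩ :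
          Additive (Mu N O) →L[ℤ] Additive (Mu N O))
      isIntertwining' := fun k => by
        apply ContinuousLinearMap.ext
        intro (x : Additive (Mu N O))
        show Additive.ofMul (γ⁻¹ • Additive.toMul (Additive.ofMul
            ((γ * ((k : K) : Γ) * γ⁻¹) • Additive.toMul x))) =
          Additive.ofMul (((k : K) : Γ) • Additive.toMul (Additive.ofMul (γ⁻¹ • Additive.toMul x)))
        rw [toMul_ofMul, toMul_ofMul, inv_smul_conj_smul] }

/-- The coefficient map `x ↦ γ x` on `μ_N(A)`, over `k' ↦ γ⁻¹ k' γ`.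
[cite: MochizukiFrdII2008, Def 2.2 (ii) p.17] -/
def muConjHomInv : TopRep.res (conjSubgroupHomInv K K' γ hK' : K' →* K) (muTopRep N O K) ⟶
    muTopRep N O K' :=
  TopRep.ofHom
    { toContinuousLinearMap :=
        (⟨Representation.ofMulDistribMulAction Γ (Mu N O) γ, continuous_of_discreteTopology⟩ :
          Additive (Mu N O) →L[ℤ] Additive (Mu N O))
      isIntertwining' := fun k' => by
        apply ContinuousLinearMap.ext
        intro (x : Additive (Mu N O))
        show Additive.ofMul (γ • Additive.toMul (Additive.ofMul
            ((γ⁻¹ * ((k' : K') : Γ) * γ⁻¹⁻¹) • Additive.toMul x))) =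
          Additive.ofMul (((k' : K') : Γ) • Additive.toMul (Additive.ofMul (γ • Additive.toMul x)))
        rw [toMul_ofMul, toMul_ofMul, inv_inv, smul_conj_inv_smul] }

/-- **Transport data for `μ_N(A)` under conjugation by `γ`.**
[cite: MochizukiFrdII2008, Def 2.2 (ii) p.17] -/
def conjTransportMu : InflTransport q q' (muTopRep N O K) (muTopRep N O K') where
  e := conjSubgroupHom γ K K' hK
  e' := conjSubgroupHomInv K K' γ hK'
  e'_e k := Subtype.ext (by simp [conjSubgroupHomInv]; group)
  e_e' k' := Subtype.ext (by simp [conjSubgroupHomInv]; group)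
  q'_eq h := Subtype.ext (by simpa using hq' h)
  f := muConjHom N O K K' γ hK
  f' := muConjHomInv N O K K' γ hK'
  f'_f x := by
    show Representation.ofMulDistribMulAction Γ (Mu N O) γ
        (Representation.ofMulDistribMulAction Γ (Mu N O) γ⁻¹ x) = x
    rw [← Module.End.mul_apply, ← map_mul, mul_inv_cancel, map_one, Module.End.one_apply]
  f_f' x := by
    show Representation.ofMulDistribMulAction Γ (Mu N O) γ⁻¹
        (Representation.ofMulDistribMulAction Γ (Mu N O) γ x) = x
    rw [← Module.End.mul_apply, ← map_mul, inv_mul_cancel, map_one, Module.End.one_apply]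

/-- **Transport data for `ℤ/Nℤ` under conjugation by `γ`** (identity on coefficients).
[cite: MochizukiFrdII2008, Def 2.2 (ii) p.17] -/
def conjTransportTriv : InflTransport q q' (trivTopRep N K) (trivTopRep N K') where
  e := conjSubgroupHom γ K K' hK
  e' := conjSubgroupHomInv K K' γ hK'
  e'_e k := Subtype.ext (by simp [conjSubgroupHomInv]; group)
  e_e' k' := Subtype.ext (by simp [conjSubgroupHomInv]; group)
  q'_eq h := Subtype.ext (by simpa using hq' h)
  f := TopRep.ofHom
    { toContinuousLinearMap := ContinuousLinearMap.id ℤ (ZMod N)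
      isIntertwining' := fun k => by ext x; rfl }
  f' := TopRep.ofHom
    { toContinuousLinearMap := ContinuousLinearMap.id ℤ (ZMod N)
      isIntertwining' := fun k => by ext x; rfl }
  f'_f x := rfl
  f_f' x := rfl

include hK hK' hq' in
/-- **Definition 2.2 (ii)(c) is "unaffected by composition with conjugation"** (FrdII p. 17):
`(N, H)`-saturation condition (c) for `(K, q)` iff for `(γ K γ⁻¹, γ q γ⁻¹)`. PROVED.
[cite: MochizukiFrdII2008, Def 2.2 (ii) p.17] -/
theorem isCohSaturated_iff_of_conj : IsCohSaturated N O K q ↔ IsCohSaturated N O K' q' := by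
  have h1 := (conjTransportMu N O K K' γ hK hK' q q' hq').bijective_iff 1
  have h1' := (conjTransportTriv N K K' γ hK hK' q q' hq').bijective_iff 1
  have h2 := (conjTransportMu N O K K' γ hK hK' q q' hq').surjective_iff 2
  constructor
  · rintro ⟨a, b, c⟩
    exact ⟨h1.mp a, h1'.mp b, h2.mp c⟩
  · rintro ⟨a, b, c⟩
    exact ⟨h1.mpr a, h1'.mpr b, h2.mpr c⟩

end Conj

/-! ### The natural action of the normaliser of `H_A` on the cohomology of `H_A` -/

section Action

variable (K : Subgroup Γ) (γ : Γ) (hK : ∀ k ∈ K, γ * k * γ⁻¹ ∈ K) (hK' : ∀ k ∈ K, γ⁻¹ * k * γ ∈ K)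

/-- The action of an element `γ` of the normaliser of `K = H_A` in `Γ` on `Hⁿ(H_A, μ_N(A))`
(continuous cohomology): induced by `k ↦ γ k γ⁻¹` on the group and `x ↦ γ⁻¹ x` on the
coefficients — "the natural actions of `(Gᵢ)_{Aᵢ}/(Hᵢ)_{Aᵢ}`" (FrdII Thm. 2.4 (i) p. 20; for
`γ ∈ H_A` it is the identity, Rmk. 2.4.1 p. 22). [cite: MochizukiFrdII2008, Thm 2.4 (i) p.20] -/
noncomputable def cohAct (n : ℕ) :
    continuousCohomology n (muTopRep N O K) ⟶ continuousCohomology n (muTopRep N O K) :=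
  ContinuousCohomology.map (conjSubgroupHom γ K K hK) (muConjHom N O K K γ hK) n

/-- The same action on `H¹(H_A, μ_N(A))` in Mathlib's group cohomology of the discrete group `H_A`
(where the Kummer classes `κ_f` of `KummerClass.lean` live).
[cite: MochizukiFrdII2008, Thm 2.4 (i) p.20] -/
noncomputable def h1Act :
    groupCohomology (Rep.ofMulDistribMulAction K (Mu N O)) 1 ⟶
      groupCohomology (Rep.ofMulDistribMulAction K (Mu N O)) 1 :=
  groupCohomology.map ((conjSubgroupHom γ K K hK : K →* K))
    (Rep.ofHom
      { toLinearMap := (Representation.ofMulDistribMulAction Γ (Mu N O) γ⁻¹ :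
          Additive (Mu N O) →ₗ[ℤ] Additive (Mu N O))
        isIntertwining' := fun k => by
          apply LinearMap.ext
          intro (x : Additive (Mu N O))
          show Additive.ofMul (γ⁻¹ • Additive.toMul (Additive.ofMul
              ((γ * ((k : K) : Γ) * γ⁻¹) • Additive.toMul x))) =
            Additive.ofMul (((k : K) : Γ) • Additive.toMul (Additive.ofMul (γ⁻¹ • Additive.toMul x)))
          rw [toMul_ofMul, toMul_ofMul, inv_smul_conj_smul] }) 1

end Action

/-! ### The induced action on `F_N(A)` -/

section FNAction

variable (K : Subgroup Γ) (γ : Γ) (hK : ∀ k ∈ K, γ * k * γ⁻¹ ∈ K) (hK' : ∀ k ∈ K, γ⁻¹ * k * γ ∈ K)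
  (q : H →ₜ* K) (c : H ≃ₜ* H) (hc : ∀ h, (q (c h) : Γ) = γ * q h * γ⁻¹)

/-- `γ q γ⁻¹ : H → K`. [cite: MochizukiFrdII2008, Def 2.2 (i) p.17] -/
def conjOfHom : H →ₜ* K := (conjSubgroupHom γ K K hK).comp q

/-- The identity of coefficients `res_c (res_q μ_N) → res_{γqγ⁻¹} μ_N` when `q ∘ c = γ q γ⁻¹`
(conjugation on `H` by a lift of `γ`). [cite: MochizukiFrdII2008, Def 2.2 (ii) p.17] -/
def resConjHom : TopRep.res ((c : H →ₜ* H) : H →* H) (TopRep.res (q : H →* K) (muTopRep N O K)) ⟶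
    TopRep.res (conjOfHom K γ hK q : H →* K) (muTopRep N O K) :=
  TopRep.ofHom
    { toContinuousLinearMap := ContinuousLinearMap.id ℤ _
      isIntertwining' := fun h => by
        apply ContinuousLinearMap.ext
        intro (x : Additive (Mu N O))
        show Additive.ofMul (((q (c h) : K) : Γ) • Additive.toMul x) =
          Additive.ofMul ((γ * ((q h : K) : Γ) * γ⁻¹) • Additive.toMul x)
        rw [hc] }

include hK' hc in
/-- **The kernel defining `F_N(A)` is stable under the action of (lifts to `G` of elements of) the
normaliser**: if `x ∈ Ker(H²(H_A, μ_N) → H²(H, μ_N))` then so is `γ · x`, because the inflation map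
intertwines `γ` with conjugation by a lift of `γ` on `H` (FrdII Def. 2.2 (ii), Thm. 2.4 (i) "natural
actions of `(Gᵢ)_{Aᵢ}/(Hᵢ)_{Aᵢ}`" on `F_N(Aᵢ)`). [cite: MochizukiFrdII2008, Thm 2.4 (i) p.20] -/
theorem cohAct_mem_fnKer {x : continuousCohomology 2 (muTopRep N O K)} (hx : x ∈ fnKer N O K q) :
    (cohAct N O K γ hK 2).hom x ∈ fnKer N O K q := by
  set q' : H →ₜ* K := conjOfHom K γ hK q with hq'def
  have hq' : ∀ h, (q' h : Γ) = γ * q h * γ⁻¹ := fun h => rfl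
  let T := conjTransportMu N O K K γ hK hK' q q' hq'
  -- the square: `infl_q (γ · x) = δ (infl_{q'} x)`
  have hsq := congr_arg (fun φ => φ.hom x) (T.square 2)
  simp only [TopModuleCat.hom_comp, ContinuousLinearMap.coe_comp, Function.comp_apply] at hsq
  -- `infl_{q'} = (conjugation on `H`) ∘ infl_q`, by functoriality along `q' = q ∘ c`
  have hfac : ContinuousCohomology.map q' (𝟙 _) 2 =
      ContinuousCohomology.map q (𝟙 _) 2 ≫
        ContinuousCohomology.map (c : H →ₜ* H) (resConjHom N O K γ hK q c hc) 2 := by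
    rw [← ContinuousCohomology.map_comp]
    exact contMap_congr (φ := q') (ψ := q.comp (c : H →ₜ* H))
      (ContinuousMonoidHom.ext fun h => Subtype.ext (by rw [hq']; exact (hc h).symm)) _ _
      (fun _ => rfl) 2
  have hx' : (ContinuousCohomology.map q' (𝟙 _) 2).hom x = 0 := by
    rw [hfac, TopModuleCat.hom_comp, ContinuousLinearMap.coe_comp, Function.comp_apply]
    have hx0 : (ContinuousCohomology.map q (𝟙 _) 2).hom x = 0 := hx
    rw [hx0, map_zero]
  show (inflTwo N O K q) ((cohAct N O K γ hK 2).hom x) = 0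
  rw [inflTwo_apply]
  change (ContinuousCohomology.map q (𝟙 _) 2).hom ((T.alpha 2).hom x) = 0
  rw [← hsq, hx', map_zero]

/-- The action of `γ` (normalising `H_A`, lifted to the conjugation `c` of `H`) on `F_N(A)`.
[cite: MochizukiFrdII2008, Thm 2.4 (i) p.20] -/
noncomputable def fnAct : FN N O K q →+ FN N O K q :=
  QuotientAddGroup.map (fnKer N O K q) (fnKer N O K q)
    (cohAct N O K γ hK 2).hom.toLinearMap.toAddMonoidHom
    (fun _ hx => cohAct_mem_fnKer N O K γ hK hK' q c hc hx)

end FNAction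

end Kummer

end Literature.AlgebraicGeometry.Frobenioids
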